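import Summits.ValiantsHypothesis.ValiantsHypothesis.Theorems.LacunarySymmetroidDoorA26StubDefs
import Summits.ValiantsHypothesis.ValiantsHypothesis.Theorems.LacunarySymmetroidMatrixDescartesCensusWindowFourBandLaw

/-!
# Route `LacunarySymmetroid`, crux `DoorA26` (stmt-ValiantsHypothesis-19979), line `census` — stub `stub_w4Band` CLOSED BY NAME

The registered stub `stub_w4Band` of the skeleton `Cruxes/DoorA26/Lines/census.lean` (sha `1fb9861a1feadc1e…`) has the one-line signature
`Stmt.stub_w4Band` (`:= W4BandLaw`, the WINDOW-4 BAND LAW in witness-free algebraic form: for the concentric trinomials `T₂`, `Φ` of an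
alternating 4-nomial with `T₂(s₁) = T₂(s₂) = 0`, `T₁(s₁) < 0 < T₁(s₂)`, at every test abscissa `t > 0`: left of centre `T₂(t) ≤ 0 ⟹ Φ(t) < 0`,
right of centre `Φ(t) ≤ 0 ⟹ T₂(t) < 0`).  Its statement is imported from `Theorems/LacunarySymmetroidDoorA26StubDefs.lean` (same namespace
`…Cruxes.DoorA26.Census`, verbatim the skeleton), and its CONTENT is the tree theorem `Census.w4BandLaw_holds` (`…CensusWindowFourBandLaw`,
val-sym-door-p1 g9: strict monotonicity of `T₂`/`Φ` on either side of the common critical abscissa and the identity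
`(u+v+w)·Φ = u·T₁ + (v+w)·x^u·T₂`) — the same statement character for character.  This file is the one-line identification, so that the stub
closes BY NAME on the ledger (`--supports stmt-ValiantsHypothesis-19979`).

HONEST FRAMING.  One-variable real analysis; kills no chamber by itself, bounds no census count; `DoorA26` (`= PosRootLawAt 2 6 19`) stays OPEN
(its line still has `stub_easyChambers` and `stub_hardChambers` open); registers unchanged (`ζ_sym(2,6) ∈ {18,19,20}`, 18 attained, never
> 18); nothing on `MatrixDescartes` (stmt-ValiantsHypothesis-18050) or on `VP ≠ VNP`.
-/

-- `Summit.ValiantsHypothesis.ValiantsHypothesis.…` repeats a component by the D-0017 layout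
-- (single-conjunct summit), which the `dupNamespace` linter flags; the name is mandated.
set_option linter.dupNamespace false

namespace Summit.ValiantsHypothesis.ValiantsHypothesis.Cruxes.DoorA26.Census

open Summit.ValiantsHypothesis.ValiantsHypothesis.Theorems.LacunarySymmetroidMatrixDescartes.Census (w4BandLaw_holds)

/-- **Registered stub 3 of the line `census` — `Stmt.stub_w4Band` (the window-4 band law `W4BandLaw`) HOLDS**, by the tree theorem
`Census.w4BandLaw_holds` (verbatim the same statement). -/
theorem stub_w4Band : Stmt.stub_w4Band := by
  unfold Stmt.stub_w4Band W4BandLaw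
  exact w4BandLaw_holds

end Summit.ValiantsHypothesis.ValiantsHypothesis.Cruxes.DoorA26.Census
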